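import Summits.AtomisticToContinuum.Crystallization.Theses.PalmUnimodularRigidity
import Summits.AtomisticToContinuum.Crystallization.Theorems.ShellsToBarlowChart.Negative.Calibration
import Literature.Geometry.DiscreteGeometry.LayerStackings
import Literature.Geometry.Manifold.GStructureDevelopment

/-!
# Line `straightening-development` for the crux `ShellsToBarlowChart` (stmt-AtomisticToContinuum-9227)

Skeleton of the line (crux-plan of idea card `Ideas/straightening-development.md`, route
`PalmUnimodularRigidity`, sub-problem `Crystallization`; line card `Lines/straightening-development.md`).

**Idea.** Straighten, don't propagate.  At every point `x` of an every-point `1 %`-good set `S`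
the fourteen true cells of the vertex star of `x` (eight near-regular tetrahedra = bonded
`4`-cliques through `x`, six near-regular octahedra = bonded `K₂,₂,₂`'s through `x`, the latter
coned from their centroids) are mapped cell-wise affinely onto the EXACT cells of the cuboctahedral
/ anticuboctahedral star of edge `2`; this is the STRAIGHTENING CHART `φ x`, used on the ball
`U x = ball x (19/25 · aₓ)` (inside the star, whose inradius is `≈ 0.8165·a`).  Transitions
`φ y ∘ (φ x)⁻¹` are single rigid motions near every common point (cell-wise isometries of
congruent regular cells agreeing on shared faces, orientation preserved), so
`{(U x, φ x)}_{x ∈ S}` is an `(ℝ³, Isom ℝ³)`-atlas on the manifold `M = ℝ³` ITSELF (the balls cover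
`ℝ³` because `S` is coarsely dense: covering radius `≤ 0.7215·a`).  `ℝ³` is simply connected, so
the tree's development theorem (`GStructure.Atlas.exists_developingMap'`) gives `D : ℝ³ → ℝ³`,
chart-wise `D = g_x ∘ φ x` on `U x` (`chartwiseDevelopment`, proved); `D` is a uniformly locally
injective / locally surjective open local homeomorphism, hence a covering map of `ℝ³`
(`isCoveringMap_of_uniform`, proved), hence a homeomorphism (`bijective_of_isCoveringMap`,
proved: monodromy on simply connected `ℝ³`); `D⁻¹` is globally `9/16`-Lipschitz
(`dist_le_of_locally_lipschitz`, proved), so image-close points are shell neighbours and the image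
`D '' S` is an EXACT unit-ball packing (Hales's normalisation: contact distance `2`) all of whose
tangent arrangements are the FCC or the HCP pattern, bonds of `S` ↔ contacts of `D '' S`
(`exactImage`, proved); Hales, *Dense Sphere Packings* §1.3 (`HalesDSP_layerPackings_holds`, in
tree) returns the Hägg word `s` and a congruence `g` with `D '' S = g '' barlowStacking 2 (2√(2/3)) s`,
and `Φ := D⁻¹ ∘ g ∘ (2 • ·)` is the bond-isomorphism (`shellsToBarlowChart_of_exactStraightening`,
proved).  The `1 %` is spent ONLY in the three local stubs; no tolerance is ever propagated.

**Registered stubs** (`sorry` only here):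
* `stub_deloneControl` (M) — shell distance window `[0.99a, 1.01a]`, hard core `0.891`, covering
  radius `≤ (29/40)·a` of an every-point-good set;
* `stub_linkExact` (M) — exact local combinatorics at `1 %` (the route's foreseen
  `PerturbedStarCombinatorics`): window graph = shell graph, links EXACTLY the pattern contact
  graph, scales of bonded points agree to `2 %`, every square of a link has a unique far apex;
* `stub_straighteningCharts` (L, HARDEST) — the perturbed-star lemma packaged as the chart family
  `StraighteningCharts S a P A φ` (exact on the closed star; continuous / open / injective on
  `U x`; uniform local surjectivity and co-Lipschitz constants `r = c = 1/40`, `K = 9/16`;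
  transitions locally rigid motions; vertex propagation across a bond), from the two stubs above.

**Proved here (no sorry):** `shellsToBarlowChart_of_exactStraightening` (the card's `Transfer:`
`C⁺ ⇒ crux`), `isomSet_rigid` / `isomSet_compClosed`, `chartwiseDevelopment`,
`isCoveringMap_of_uniform` (the card's First lemma), `bijective_of_isCoveringMap`,
`dist_le_of_locally_lipschitz`, `exactImage`, `exactStraightening_of` (the glue: atlas, development,
covering, homeomorphism, inverse Lipschitz bound, exact image) and the composition
`ShellsToBarlowChart_of` (stub statements ⇒ crux BY NAME), plus `shellsToBarlowChart_via_stubs`.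

**Disproof used** (`Cruxes/ShellsToBarlowChart/Disproof.lean`, cycles 1–2; landed parts imported
from `Theorems/ShellsToBarlowChart/Negative/Calibration.lean`): `S.Nonempty`
(`shellsToBarlowChart_false_without_nonempty`) is consumed in the transfer (Hales needs
`V.Nonempty`) and in `stub_deloneControl.covering`; both ends of the scale window
(`…_false_without_scaleUpper/Lower`) are consumed where the disprover locates them — the
identification bond window `(0, 28/25]` = first-shell relation: `stub_linkExact.window/link`
(`1.02·a ≤ 28/25 < 1.2548·(9/10)…`) and `exactImage` (`2·(9/16) = 9/8 ≤ 5a/4` needs `a ≥ 9/10`);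
`↑T = shell` (`shellsToBarlowChart_false_subshell`) is consumed in `stub_deloneControl.hard_core`
/ `covering`, in `stub_linkExact.window` and in `stub_straighteningCharts` (face-to-face star with
no foreign vertex); the refuted METRIC strengthening (log-spiral drift; two nearest-neighbour
distances) is respected: `D` is only locally bi-Lipschitz and no global similarity is claimed;
`not_shellsToFccChart` is respected: the Hägg word is READ OFF `D '' S` by Hales's theorem.
-/

noncomputable section

namespace Summit.AtomisticToContinuum.Crystallization.Cruxes.ShellsToBarlowChart.StraighteningDevelopment

open Set Function Filter Metric Topology
open Literature.Geometry.DiscreteGeometry Literature.MathematicalPhysics.StatisticalMechanics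
open Literature.Geometry.Manifold
open Summit.AtomisticToContinuum.Crystallization.Theses.PalmUnimodularRigidity (ShellsToBarlowChart)
open Summit.AtomisticToContinuum.Crystallization.Theorems.ShellsToBarlowChartNegative

/-- Euclidean `3`-space. -/
local notation "E3" => EuclideanSpace ℝ (Fin 3)

/-! ## Vocabulary (all definitions transparent; the crux itself is never restated) -/

/-- The per-point hypothesis of the crux at `x ∈ S` with the scale `a` EXPOSED (the body of
`GoodShellAt (9/10) 1 S x`): `a ∈ [9/10, 1]` and the recentred `5a/4`-shell is `(a/100)`-matched,
after a linear isometry, to the `a`-scaled FCC or HCP kissing pattern. -/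
def AdmissibleScale (S : Set E3) (x : E3) (a : ℝ) : Prop :=
  9 / 10 ≤ a ∧ a ≤ 1 ∧ ∃ T : Finset E3,
    (↑T : Set E3) = (fun y : E3 => y - x) '' {y : E3 | y ∈ S ∧ y ≠ x ∧ dist y x ≤ 5 / 4 * a} ∧
    (ShellCloseTo (a / 100) T (Finset.image (fun v : E3 => a • v) fccKissingPattern) ∨
      ShellCloseTo (a / 100) T (Finset.image (fun v : E3 => a • v) hcpKissingPattern))

/-- `GoodShellAt (9/10) 1 S x ↔ ∃ a, AdmissibleScale S x a` (definitional unfolding). -/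
theorem goodShellAt_iff_exists_admissibleScale (S : Set E3) (x : E3) :
    GoodShellAt (9 / 10) 1 S x ↔ ∃ a, AdmissibleScale S x a := by
  simp only [GoodShellAt, AdmissibleScale]

/-- The first coordination shell of `x` in `S` at scale `a`: the points of `S ∖ {x}` within
`5a/4` of `x`. -/
def shell (S : Set E3) (x : E3) (a : ℝ) : Set E3 :=
  {y : E3 | y ∈ S ∧ y ≠ x ∧ dist y x ≤ 5 / 4 * a}

/-- The bond relation of the crux's conclusion: `0 < dist x y ≤ 28/25`. -/
def Bond (x y : E3) : Prop := 0 < dist x y ∧ dist x y ≤ 28 / 25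

/-- The structure set of the straightening atlas: the isometries of `ℝ³`, as self-maps. -/
def isomSet : Set (E3 → E3) := Set.range (fun g : E3 ≃ᵢ E3 => (g : E3 → E3))

/-- **`C⁺` of the line (the card's `Transfer:`).**  Every non-empty every-point-good `S` is
straightened by a HOMEOMORPHISM `D` of `ℝ³` onto an exact packing: `D '' S` is a packing of unit
balls (Hales's normalisation, contact distance `2`) all of whose tangent arrangements are the
FCC or the HCP pattern, and the bonds of `S` are exactly the contacts of `D '' S`. -/
def ExactStraightening : Prop :=
  ∀ S : Set E3, S.Nonempty → (∀ x ∈ S, GoodShellAt (9 / 10) 1 S x) →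
    ∃ D : E3 ≃ₜ E3, IsUnitBallPacking (D '' S) ∧ HasFccOrHcpShells (D '' S) ∧
      ∀ x ∈ S, ∀ y ∈ S, (Bond x y ↔ dist (D x) (D y) = 2)

/-! ## The transfer `C⁺ ⇒ crux` (PROVED) -/

/-- **Transfer.** `ExactStraightening → ShellsToBarlowChart`: Hales DSP §1.3
(`HalesDSP_layerPackings_holds`) writes `D '' S = g '' barlowStacking 2 (2√(2/3)) s`; the
bond-isomorphism is `Φ := D⁻¹ ∘ g ∘ (2 • ·)` on `barlowStacking 1 √(2/3) s`, and
`dist p q = 1 ↔ dist (2p) (2q) = 2 ↔ Bond (Φ p) (Φ q)`. [cite: HalesDSP2012, §1.3] -/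
theorem shellsToBarlowChart_of_exactStraightening (h : ExactStraightening) : ShellsToBarlowChart := by
  rw [shellsToBarlowChart_iff_scaled]
  intro S hS hgood
  obtain ⟨D, hpack, hsh, hbond⟩ := h S hS hgood
  have hne : ((D : E3 → E3) '' S).Nonempty := hS.image _
  obtain ⟨s, hs, g, hV⟩ := HalesDSP_layerPackings_holds _ hpack hne hsh
  -- scaling between the unit stacking and Hales's stacking
  have two_smul_mem : ∀ {p : E3}, p ∈ barlowStacking 1 (Real.sqrt (2 / 3)) s →
      (2 : ℝ) • p ∈ barlowStacking 2 (2 * Real.sqrt (2 / 3)) s := by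
    intro p hp
    have h2 := (smul_mem_barlowStacking_iff (t := (2 : ℝ)) (a := 1) (h := Real.sqrt (2 / 3))
      two_ne_zero (s := s) (x := p)).2 hp
    rwa [mul_one] at h2
  have half_smul_mem : ∀ {z : E3}, z ∈ barlowStacking 2 (2 * Real.sqrt (2 / 3)) s →
      (1 / 2 : ℝ) • z ∈ barlowStacking 1 (Real.sqrt (2 / 3)) s := by
    intro z hz
    have h2 := (smul_mem_barlowStacking_iff (t := (1 / 2 : ℝ)) (a := 2)
      (h := 2 * Real.sqrt (2 / 3)) (by norm_num) (s := s) (x := z)).2 hz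
    have e1 : (1 / 2 : ℝ) * 2 = 1 := by norm_num
    have e2 : (1 / 2 : ℝ) * (2 * Real.sqrt (2 / 3)) = Real.sqrt (2 / 3) := by ring
    rwa [e1, e2] at h2
  -- image points of the doubled stacking come from `S`
  have himg : ∀ {p : E3}, p ∈ barlowStacking 1 (Real.sqrt (2 / 3)) s →
      ∃ y ∈ S, D y = g ((2 : ℝ) • p) := by
    intro p hp
    have : g ((2 : ℝ) • p) ∈ (D : E3 → E3) '' S := by
      rw [hV]; exact ⟨_, two_smul_mem hp, rfl⟩
    obtain ⟨y, hy, hyp⟩ := this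
    exact ⟨y, hy, hyp⟩
  refine ⟨s, hs, fun p => D.symm (g ((2 : ℝ) • p)), ⟨?_, ?_, ?_⟩, ?_⟩
  · -- maps into `S`
    intro p hp
    obtain ⟨y, hy, hyp⟩ := himg hp
    simp only
    rw [← hyp, Homeomorph.symm_apply_apply]
    exact hy
  · -- injective
    intro p _ q _ hpq
    simp only at hpq
    have h1 : g ((2 : ℝ) • p) = g ((2 : ℝ) • q) := D.symm.injective hpq
    have h2 : (2 : ℝ) • p = (2 : ℝ) • q := g.injective h1
    exact smul_right_injective E3 (two_ne_zero) h2
  · -- onto `S`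
    intro y hy
    have : D y ∈ (g : E3 → E3) '' barlowStacking 2 (2 * Real.sqrt (2 / 3)) s := by
      rw [← hV]; exact ⟨y, hy, rfl⟩
    obtain ⟨z, hz, hzy⟩ := this
    refine ⟨(1 / 2 : ℝ) • z, half_smul_mem hz, ?_⟩
    simp only
    rw [smul_smul, show (2 : ℝ) * (1 / 2) = 1 by norm_num, one_smul, hzy,
      Homeomorph.symm_apply_apply]
  · -- bonds
    intro p hp q hq
    obtain ⟨x, hx, hxp⟩ := himg hp
    obtain ⟨y, hy, hyq⟩ := himg hq
    have hΦp : D.symm (g ((2 : ℝ) • p)) = x := by rw [← hxp, Homeomorph.symm_apply_apply]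
    have hΦq : D.symm (g ((2 : ℝ) • q)) = y := by rw [← hyq, Homeomorph.symm_apply_apply]
    simp only
    rw [hΦp, hΦq]
    have key := hbond x hx y hy
    rw [hxp, hyq, g.dist_eq, dist_smul₀, Real.norm_two] at key
    unfold Bond at key
    rw [key]
    constructor
    · intro h1; rw [h1]; norm_num
    · intro h2; linarith

/-! ## Stub 1 — Delone control of an every-point-good set (specific, M) -/

/-- **Delone control.**  Consequences of the shells alone, uniformly over all admissible scales:
(i) shell points of `x` lie at distance in `[0.99·a, 1.01·a]` (they are `(a/100)`-matched to
pattern points of norm `a`); (ii) hard core: distinct points of `S` are `≥ 0.891` apart (a closer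
point would be a shell point, by `↑T = shell`); (iii) coarse density: every `p ∈ ℝ³` is within
`(29/40)·a` of some `x ∈ S` (its nearest site, which exists by the hard core: the deepest hole of
either 12-point pattern subtends exactly `45°`, blurred to `45.58°` by the matching, so
`dist p x ≤ 1.01·a/(2 cos 45.58°) < 0.7215·a`). -/
structure DeloneControl (S : Set E3) : Prop where
  /-- shell points sit in the distance window `[0.99 a, 1.01 a]` -/
  shell_window : ∀ x ∈ S, ∀ a : ℝ, AdmissibleScale S x a → ∀ y ∈ shell S x a,
    99 / 100 * a ≤ dist y x ∧ dist y x ≤ 101 / 100 * a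
  /-- hard core `0.891` -/
  hard_core : ∀ x ∈ S, ∀ y ∈ S, x ≠ y → (891 / 1000 : ℝ) ≤ dist x y
  /-- covering radius `(29/40)·a`, realised by one site `x` for every admissible scale at `x` -/
  covering : ∀ p : E3, ∃ x ∈ S, ∀ a : ℝ, AdmissibleScale S x a → dist p x ≤ 29 / 40 * a

/-- **stub (M): Delone control** — the three metric consequences of every-point `1 %`-good shells
(distance window of shell points, hard core, covering radius).  Plausibly true with the margins of
`Disproof.lean` (`margins`, `hardCore_bounds`) and the `45°` covering angle of both patterns
(triage capcheck: `44.9°–45.0°`; identical for FCC/HCP); Lean cost: a finite computation on the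
two integer pattern models (`fccInt`, `hcpInt`), closedness of a uniformly discrete set and
existence of a nearest point in the proper space `ℝ³`. -/
theorem stub_deloneControl (S : Set E3) (hS : S.Nonempty)
    (hgood : ∀ x ∈ S, GoodShellAt (9 / 10) 1 S x) : DeloneControl S := by
  sorry

/-! ## Stub 2 — exact local combinatorics at `1 %` (specific, M) -/

/-- **Exact link combinatorics at `x`** (the route's foreseen `PerturbedStarCombinatorics`, per
point): with an admissible scale `a`, a pattern `P ∈ {FCC, HCP}`, a frame `A` and the LABEL map
`ℓ : shell → P` (the matching of the hypothesis read as a bijection onto the unit pattern, with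
`y − x` within `a/100` of `a · A (ℓ y)`): the bond window sees exactly the shell (`window`), the
bonds among shell points are EXACTLY the pattern contacts (`link`), scales of bonded points agree
to `2 %` (`scale`), and over every square `y₁ y₂ y₃ y₄` of the link (a labelled `4`-cycle with
diagonal `√2`) sits a unique far apex `w ∈ S ∖ {x}` bonded to its four corners, at distance in
`(5a/4, 3a/2]` from `x` (`apex`; it is read off the shell of `y₁`). -/
structure LinkExactAt (S : Set E3) (x : E3) (a : ℝ) (P : Finset E3) (A : E3 →ₗᵢ[ℝ] E3)
    (ℓ : E3 → E3) : Prop where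
  /-- the scale is admissible for the crux hypothesis at `x` -/
  adm : AdmissibleScale S x a
  /-- the pattern is the FCC or the HCP kissing pattern -/
  pattern : P = fccKissingPattern ∨ P = hcpKissingPattern
  /-- the label map is a bijection from the shell onto the unit pattern -/
  label_bij : BijOn ℓ (shell S x a) ↑P
  /-- each shell point is within `a/100` of its scaled, rotated label -/
  label_close : ∀ y ∈ shell S x a, dist (y - x) (a • A (ℓ y)) ≤ a / 100
  /-- the bond window `(0, 28/25]` sees exactly the shell (`Disproof.margins` (1), (2)) -/
  window : ∀ y ∈ S, (Bond x y ↔ y ∈ shell S x a)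
  /-- bonds among shell points are exactly the pattern contacts (`Disproof.margins` (3), (4)) -/
  link : ∀ y ∈ shell S x a, ∀ z ∈ shell S x a, (Bond y z ↔ dist (ℓ y) (ℓ z) = 1)
  /-- scales of bonded points agree to `2 %` -/
  scale : ∀ y ∈ shell S x a, ∀ a' : ℝ, AdmissibleScale S y a' →
    99 / 100 * a ≤ 101 / 100 * a' ∧ 99 / 100 * a' ≤ 101 / 100 * a
  /-- every labelled square of the link has a unique far apex in `S ∖ {x}` -/
  apex : ∀ y₁ ∈ shell S x a, ∀ y₂ ∈ shell S x a, ∀ y₃ ∈ shell S x a, ∀ y₄ ∈ shell S x a,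
    dist (ℓ y₁) (ℓ y₂) = 1 → dist (ℓ y₂) (ℓ y₃) = 1 → dist (ℓ y₃) (ℓ y₄) = 1 →
    dist (ℓ y₄) (ℓ y₁) = 1 → dist (ℓ y₁) (ℓ y₃) = Real.sqrt 2 →
    ∃ w ∈ S, w ≠ x ∧ Bond w y₁ ∧ Bond w y₂ ∧ Bond w y₃ ∧ Bond w y₄ ∧
      (∀ w' ∈ S, w' ≠ x → Bond w' y₁ → Bond w' y₂ → Bond w' y₃ → Bond w' y₄ → w' = w) ∧
      5 / 4 * a < dist w x ∧ dist w x ≤ 3 / 2 * a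

/-- **stub (M): links are exact at `1 %`.**  Every point of `S` carries `LinkExactAt` data.
Why plausibly true: `Disproof.margins` (shell pairs `≤ 1.01a ≤ 28/25 < 1.125 ≤ 5a/4`;
pattern-adjacent shell points `≤ 1.02a`, non-adjacent `≥ (√2 − 0.02)a ≥ 1.2548`), so the window
graph is the shell graph and every link is exactly the (anti)cuboctahedron graph; the apex over a
square `x, y₂, y₄ ∈ shell y₁` is the shell point of `y₁` labelled by the fourth corner of the
unique square face of `P_{y₁}` through the labels of `x, y₂, y₄` (two non-adjacent neighbours of
a pattern point at mutual distance `√2` span a unique square; the `√2`-pair has exactly two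
common neighbours — `decide` on `fccInt` / `hcpInt`), and it is bonded to `y₃` by the same
argument in the shell of `y₂`.  Lean cost: `EtaMatched` bookkeeping + finite pattern facts. -/
theorem stub_linkExact (S : Set E3) (hS : S.Nonempty)
    (hgood : ∀ x ∈ S, GoodShellAt (9 / 10) 1 S x) :
    ∀ x ∈ S, ∃ (a : ℝ) (P : Finset E3) (A : E3 →ₗᵢ[ℝ] E3) (ℓ : E3 → E3),
      LinkExactAt S x a P A ℓ := by
  sorry

/-! ## Stub 3 — the straightening charts (specific, L, HARDEST) -/

/-- **The straightening chart family of `S`** (output of the perturbed-star lemma).  Data: a scale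
`a x`, a pattern `P x ∈ {FCC, HCP}`, a frame `A x` and a chart `φ x : ℝ³ → ℝ³` for each `x`
(only `x ∈ S` matters); chart domains `U x := ball x (19/25 · a x)`.  Intended witness: `a x, A x,
P x` and labels from `LinkExactAt`; `φ x` = the cell-wise affine straightening of the true vertex
star of `x` (tetrahedra = `x` + pairwise bonded triples of the shell; octahedra = `x` + a square
of the link + its far apex, coned from the centroid into eight sub-tetrahedra) onto the exact star
of edge `2`, with `x ↦ 0`, shell point `y ↦ 2 · A x (ℓ y)`, apex `↦ 2 · A x (ℓ y₁ + ℓ y₃)`.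
Axioms: exactness on the closed star (`map_self`, `image_shell`); regularity on `U x`
(`continuousOn`, `nhds_le` = open at points, `injOn`); the two UNIFORM constants of the covering
criterion (`surjOn`: `ball (φ x p) (1/40) ⊆ φ x '' ball p (1/40)` and `coLipschitz`:
`dist q q' ≤ 9/16 · dist (φ x q) (φ x q')` on `ball p (1/80)`, whenever `ball p (1/40) ⊆ U x` —
the inverse straightening is cell-wise affine with Lipschitz constant `≤ (a/2)(1 + 12.5 %)`);
`compat`: transitions are single rigid motions near each common point (the true cells through `p`
are common to both stars and face-connected around `p`, both straightenings preserve
orientation); `vertex`: two developed charts that agree on `U x ∩ U y` agree at the vertex `y`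
(affine maps agreeing on an open subset of a common cell agree on it). -/
structure StraighteningCharts (S : Set E3) (a : E3 → ℝ) (P : E3 → Finset E3)
    (A : E3 → (E3 →ₗᵢ[ℝ] E3)) (φ : E3 → E3 → E3) : Prop where
  /-- the scale used at `x` is admissible for the crux hypothesis -/
  adm : ∀ x ∈ S, AdmissibleScale S x (a x)
  /-- the pattern at `x` is the FCC or the HCP kissing pattern -/
  pattern : ∀ x ∈ S, P x = fccKissingPattern ∨ P x = hcpKissingPattern
  /-- the chart centres `x` at the origin -/
  map_self : ∀ x ∈ S, φ x x = 0
  /-- the chart maps the first shell of `x` onto the exact pattern at Hales's radius `2` -/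
  image_shell : ∀ x ∈ S, φ x '' shell S x (a x) = (fun v : E3 => (2 : ℝ) • A x v) '' ↑(P x)
  /-- continuity on the chart domain -/
  continuousOn : ∀ x ∈ S, ContinuousOn (φ x) (ball x (19 / 25 * a x))
  /-- openness at the points of the chart domain -/
  nhds_le : ∀ x ∈ S, ∀ p ∈ ball x (19 / 25 * a x), 𝓝 (φ x p) ≤ map (φ x) (𝓝 p)
  /-- injectivity on the chart domain -/
  injOn : ∀ x ∈ S, InjOn (φ x) (ball x (19 / 25 * a x))
  /-- uniform local surjectivity: radius `1/40` balls deep inside `U x` cover `1/40` balls -/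
  surjOn : ∀ x ∈ S, ∀ p : E3, ball p (1 / 40) ⊆ ball x (19 / 25 * a x) →
    ball (φ x p) (1 / 40) ⊆ φ x '' ball p (1 / 40)
  /-- uniform local co-Lipschitz constant `9/16` (inverse straightening is `(a/2)(1+δ)`-Lipschitz) -/
  coLipschitz : ∀ x ∈ S, ∀ p : E3, ball p (1 / 40) ⊆ ball x (19 / 25 * a x) →
    ∀ q ∈ ball p (1 / 80), ∀ q' ∈ ball p (1 / 80), dist q q' ≤ 9 / 16 * dist (φ x q) (φ x q')
  /-- transitions are locally rigid motions -/
  compat : ∀ x ∈ S, ∀ y ∈ S, ∀ p : E3, p ∈ ball x (19 / 25 * a x) → p ∈ ball y (19 / 25 * a y) →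
    ∃ g : E3 ≃ᵢ E3, φ y =ᶠ[𝓝 p] (g : E3 → E3) ∘ φ x
  /-- vertex propagation across a bond: developed charts agreeing on `U x ∩ U y` agree at `y` -/
  vertex : ∀ x ∈ S, ∀ y ∈ shell S x (a x), ∀ g g' : E3 ≃ᵢ E3,
    (∀ p : E3, p ∈ ball x (19 / 25 * a x) → p ∈ ball y (19 / 25 * a y) → g (φ x p) = g' (φ y p)) →
    g (φ x y) = g' (φ y y)

/-- **stub (L, hardest): the straightening charts exist** — the perturbed-star lemma.  From the
Delone control and the exact link combinatorics: the fourteen true cells of every vertex star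
are positively oriented `3 %`-perturbations of regular cells of edge `≈ a` (a regular tetrahedron
of edge `≥ 0.97a` cannot invert under vertex moves `≤ 0.03a`), they tile a neighbourhood of `x`
containing `closedBall x (0.80·a)` face to face (every point of a tetrahedral far face is
`≥ (0.8165 − 0.01)a` from `x`, of an octahedral far face `≥ (0.866 − 0.01)a`), true cells of the
double star do not overlap (hard core: no foreign vertex within a cell), and the cell-wise affine
straightening is a bi-Lipschitz homeomorphism onto the exact star with the constants recorded in
`StraighteningCharts` (error budget of the inverse, adversarial hill-climb of the line card:
tetrahedra `≤ 0.512·a`, octahedral sub-tetrahedra `≤ 0.543·a` at the crude far-apex error bound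
`0.061a`, against `9/16 = 0.5625` — the TIGHTEST constant of the line, margin `3.5 %`; all cells
stay positively oriented, determinant ratio `≥ 0.89`).  Why it might
fail: only through a constant (`19/25`, `1/40`, `9/16`) chosen too tight — the statement with
SOME constants `ρ > 0.7215`, `r > 0`, `K < 5/8 · a_min` is the content; kit falsifier of the card
((1b)/(1c)) not yet run. -/
theorem stub_straighteningCharts (S : Set E3) (hS : S.Nonempty)
    (hgood : ∀ x ∈ S, GoodShellAt (9 / 10) 1 S x) (hD : DeloneControl S)
    (hlink : ∀ x ∈ S, ∃ (a : ℝ) (P : Finset E3) (A : E3 →ₗᵢ[ℝ] E3) (ℓ : E3 → E3),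
      LinkExactAt S x a P A ℓ) :
    ∃ (a : E3 → ℝ) (P : E3 → Finset E3) (A : E3 → (E3 →ₗᵢ[ℝ] E3)) (φ : E3 → E3 → E3),
      StraighteningCharts S a P A φ := by
  sorry

/-! ## Generic topology (PROVED): chart-wise development, covering criterion, monodromy,
Lipschitz globalisation -/

/-- `isomSet` is non-empty. [folklore] -/
theorem isomSet_nonempty : isomSet.Nonempty := ⟨_, IsometryEquiv.refl E3, rfl⟩

/-- `isomSet` is closed under composition. [folklore] -/
theorem isomSet_compClosed : GStructure.Atlas.CompClosed isomSet := by
  rintro _ ⟨g, rfl⟩ _ ⟨h, rfl⟩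
  exact ⟨h.trans g, rfl⟩

/-- `isomSet` is rigid: two isometries of `ℝ³` that agree near one point agree everywhere
(Mazur–Ulam: they are affine, and an open set affinely spans `ℝ³`). [folklore] -/
theorem isomSet_rigid : GStructure.Atlas.Rigid isomSet := by
  rintro _ ⟨g, rfl⟩ _ ⟨h, rfl⟩ p hgh
  obtain ⟨U, hU, hUo, hpU⟩ := _root_.mem_nhds_iff.mp hgh
  have hspan : affineSpan ℝ U = ⊤ := hUo.affineSpan_eq_top ⟨p, hpU⟩
  have key : g.toRealAffineIsometryEquiv.toAffineEquiv =
      h.toRealAffineIsometryEquiv.toAffineEquiv := by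
    refine AffineEquiv.ext_on hspan _ _ (fun x hx => ?_)
    have := hU hx
    simpa using this
  funext x
  have := congrArg (fun e : E3 ≃ᵃ[ℝ] E3 => e x) key
  simpa using this

/-- **Chart-wise development** (uniqueness of continuation on connected chart domains).  For an
`(ℝ³, G)`-atlas on `ℝ³` with preconnected chart domains, `G` rigid, composition-closed and
non-empty, there is a developing map `D` which on EVERY chart domain is of the form `g ∘ φ i`,
`g ∈ G`, near each of its points, with ONE `g` per chart: take `D` from
`GStructure.Atlas.exists_developingMap'`; on `U i` the sets `{x | D = g ∘ φ i near x}`, `g ∈ G`,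
are open, cover `U i` (change of chart by `compat`) and are pairwise disjoint (rigidity of `G`
and charts open at points), so one of them contains the preconnected `U i`.
[cite: BenedettiPetronio1992, Prop. B.1.3] -/
theorem chartwiseDevelopment {ι : Type} {G : Set (E3 → E3)} (At : GStructure.Atlas G ι E3)
    (hG : GStructure.Atlas.Rigid G) (hc : GStructure.Atlas.CompClosed G) (hne : G.Nonempty)
    (hconn : ∀ i, IsPreconnected (At.U i)) :
    ∃ D : E3 → E3, ∀ i, ∃ g ∈ G, ∀ p ∈ At.U i, D =ᶠ[𝓝 p] g ∘ At.φ i := by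
  haveI : ContractibleSpace E3 := RealTopologicalVectorSpace.contractibleSpace
  haveI : SimplyConnectedSpace E3 := inferInstance
  obtain ⟨D, hD⟩ := GStructure.Atlas.exists_developingMap' (A := At) hG hc hne
  refine ⟨D, fun i => ?_⟩
  -- every point of `U i` has a local representation through the chart `i`
  have hrep : ∀ p ∈ At.U i, ∃ g ∈ G, D =ᶠ[𝓝 p] g ∘ At.φ i := by
    intro p hp
    obtain ⟨j, g', hpj, hg', hDj⟩ := hD p
    obtain ⟨t, ht, hφ⟩ := At.compat i j p hp hpj
    exact ⟨g' ∘ t, hc g' hg' t ht, hDj.trans (hφ.fun_comp g')⟩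
  -- the representing element near a point of `U i` is unique
  have huniq : ∀ p ∈ At.U i, ∀ g ∈ G, ∀ g' ∈ G,
      D =ᶠ[𝓝 p] g ∘ At.φ i → D =ᶠ[𝓝 p] g' ∘ At.φ i → g = g' := by
    intro p hp g hg g' hg' h1 h2
    have h3 : g ∘ At.φ i =ᶠ[𝓝 p] g' ∘ At.φ i := h1.symm.trans h2
    have h4 : ∀ᶠ z in map (At.φ i) (𝓝 p), g z = g' z := Filter.eventually_map.mpr h3
    exact hG g hg g' hg' (At.φ i p) (h4.filter_mono (At.nhds_le i p hp))
  by_cases hU : (At.U i).Nonempty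
  swap
  · obtain ⟨g, hg⟩ := hne
    exact ⟨g, hg, fun p hp => (hU ⟨p, hp⟩).elim⟩
  obtain ⟨p₀, hp₀⟩ := hU
  obtain ⟨g₀, hg₀, hD₀⟩ := hrep p₀ hp₀
  refine ⟨g₀, hg₀, fun p hp => ?_⟩
  by_contra hcon
  set W : Set E3 := {q | D =ᶠ[𝓝 q] g₀ ∘ At.φ i} with hW
  set W' : Set E3 := {q | ∃ g ∈ G, g ≠ g₀ ∧ D =ᶠ[𝓝 q] g ∘ At.φ i} with hW'
  have hWo : IsOpen W := by
    rw [isOpen_iff_mem_nhds]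
    intro q hq
    exact hq.eventually_nhds
  have hW'o : IsOpen W' := by
    rw [isOpen_iff_mem_nhds]
    rintro q ⟨g, hg, hgg, hDq⟩
    filter_upwards [hDq.eventually_nhds] with z hz
    exact ⟨g, hg, hgg, hz⟩
  have hcover : At.U i ⊆ W ∪ W' := fun q hq => by
    obtain ⟨g, hg, hDq⟩ := hrep q hq
    by_cases hgg : g = g₀
    · left
      rw [hgg] at hDq
      exact hDq
    · right
      exact ⟨g, hg, hgg, hDq⟩
  have h1 : (At.U i ∩ W).Nonempty := ⟨p₀, hp₀, hD₀⟩
  have h2 : (At.U i ∩ W').Nonempty := by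
    obtain ⟨g, hg, hDp⟩ := hrep p hp
    refine ⟨p, hp, g, hg, ?_, hDp⟩
    rintro rfl
    exact hcon hDp
  obtain ⟨q, hqU, hqW, hqW'⟩ := hconn i W W' hWo hW'o hcover h1 h2
  obtain ⟨g, hg, hgg, hDq⟩ := hqW'
  exact hgg (huniq q hqU g hg g₀ hg₀ hDq hqW)

/-- **Covering criterion** (the idea card's First lemma `isCoveringMap_of_uniform`; Browder 1954 /
Plastock 1974 / F. John 1968 in classical dress).  A continuous open self-map of `ℝ³` which is
injective on every `r`-ball and whose images of `r`-balls contain the concentric `c`-balls is a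
covering map: it is onto (the range is open, and closed because a limit of image points lies in a
`c`-ball around an image point); fibres are `r`-separated hence discrete; over `W = ball y c` the
sheets `ball e r ∩ f⁻¹ W`, `e ∈ f⁻¹ y`, are pairwise disjoint (two of them meeting at `z` put both
`e`'s in `ball z r`, contradicting `hinj`), cover `f⁻¹ W` (`hsur` at `z` puts a fibre point in
`ball z r`) and map homeomorphically onto `W` (continuous, open, injective; onto by `hsur` at
`e`); Mathlib's `IsOpen.trivializationDiscrete` assembles the even covering. [folklore] -/
theorem isCoveringMap_of_uniform (f : E3 → E3) (r c : ℝ) (hf : Continuous f) (ho : IsOpenMap f)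
    (hr : 0 < r) (hc : 0 < c) (hinj : ∀ p : E3, InjOn f (ball p r))
    (hsur : ∀ p : E3, ball (f p) c ⊆ f '' ball p r) : IsCoveringMap f := by
  -- `f` is onto: the range is open and closed
  have hsurj : Surjective f := by
    have hopen : IsOpen (range f) := ho.isOpen_range
    have hclosed : IsClosed (range f) := by
      rw [← isOpen_compl_iff, isOpen_iff_mem_nhds]
      intro y hy
      refine mem_of_superset (isOpen_ball.mem_nhds (mem_ball_self hc)) fun x hx hxr => ?_
      obtain ⟨z, rfl⟩ := hxr
      have hy' : y ∈ ball (f z) c := by rw [mem_ball, dist_comm]; exact hx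
      obtain ⟨w, -, hw⟩ := hsur z hy'
      exact hy ⟨w, hw⟩
    exact Set.range_eq_univ.1 (IsClopen.eq_univ ⟨hclosed, hopen⟩ (range_nonempty f))
  intro q
  -- the fibre over `q` is discrete and nonempty
  haveI : DiscreteTopology (f ⁻¹' {q}) := by
    refine (isDiscrete_iff_forall_mem_exists_isOpen.mpr fun e he => ?_).to_subtype
    refine ⟨ball e r, isOpen_ball,
      subset_antisymm ?_ (singleton_subset_iff.mpr ⟨mem_ball_self hr, he⟩)⟩
    rintro e' ⟨he'b, he'⟩
    have h1 : f e' = f e := by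
      rw [mem_preimage, mem_singleton_iff] at he he'
      rw [he, he']
    exact mem_singleton_iff.mpr (hinj e he'b (mem_ball_self hr) h1)
  haveI : Nonempty (f ⁻¹' {q}) := by
    obtain ⟨α, hα⟩ := hsurj q
    exact ⟨⟨α, hα⟩⟩
  set V : Set E3 := ball q c with hV
  set U : (f ⁻¹' {q}) → Set E3 := fun α => ball (α : E3) r ∩ f ⁻¹' V with hU
  have hfα : ∀ α : f ⁻¹' {q}, f α = q := fun α => α.2
  -- points of `V` lift into each sheet
  have hlift : ∀ (α : f ⁻¹' {q}), ∀ x ∈ V, ∃ z ∈ U α, f z = x := by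
    intro α x hx
    have hx' : x ∈ ball (f (α : E3)) c := by rw [hfα]; exact hx
    obtain ⟨z, hz, hzx⟩ := hsur α hx'
    refine ⟨z, ⟨hz, ?_⟩, hzx⟩
    show f z ∈ V
    rw [hzx]; exact hx
  have hopen_iff : ∀ α {W : Set E3}, W ⊆ V → (IsOpen W ↔ IsOpen (f ⁻¹' W ∩ U α)) := by
    intro α W hWV
    refine ⟨fun hW => (hW.preimage hf).inter (isOpen_ball.inter (isOpen_ball.preimage hf)),
      fun hW' => ?_⟩
    have himage : f '' (f ⁻¹' W ∩ U α) = W := by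
      apply subset_antisymm
      · rintro _ ⟨z, ⟨hzW, -⟩, rfl⟩
        exact hzW
      · intro x hxW
        obtain ⟨z, hzU, hzx⟩ := hlift α x (hWV hxW)
        refine ⟨z, ⟨?_, hzU⟩, hzx⟩
        show f z ∈ W
        rw [hzx]; exact hxW
    rw [← himage]
    exact ho _ hW'
  have hinjU : ∀ α, (U α).InjOn f := fun α => (hinj (α : E3)).mono inter_subset_left
  have hsurjOn : ∀ α, (U α).SurjOn f V := fun α x hx => hlift α x hx
  have hdisj : Pairwise (Disjoint on U) := by
    intro α β hne
    refine Set.disjoint_left.2 fun z hzα hzβ => hne ?_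
    have hα : (α : E3) ∈ ball z r := by rw [mem_ball, dist_comm]; exact hzα.1
    have hβ : (β : E3) ∈ ball z r := by rw [mem_ball, dist_comm]; exact hzβ.1
    exact Subtype.ext (hinj z hα hβ (by rw [hfα, hfα]))
  have hexh : f ⁻¹' V ⊆ ⋃ α, U α := by
    intro z hz
    have hq : q ∈ ball (f z) c := by rw [mem_ball, dist_comm]; exact hz
    obtain ⟨α, hα, hαq⟩ := hsur z hq
    have hzα : z ∈ ball α r := by rw [mem_ball, dist_comm]; exact hα
    exact mem_iUnion.2 ⟨⟨α, hαq⟩, hzα, hz⟩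
  exact IsEvenlyCovered.of_trivialization
    (t := IsOpen.trivializationDiscrete U V isOpen_ball hopen_iff hinjU hsurjOn hdisj hexh)
    (mem_ball_self hc)

/-- **A covering map `ℝ³ → ℝ³` is bijective** (monodromy: lift `id` through `f` to a section
`s`, `f ∘ s = id`; `s ∘ f` and `id` are two lifts of `f` through `f` agreeing at one point, so
`s ∘ f = id`). [folklore] -/
theorem bijective_of_isCoveringMap {f : E3 → E3} (hf : IsCoveringMap f) : Bijective f := by
  haveI : ContractibleSpace E3 := RealTopologicalVectorSpace.contractibleSpace
  haveI : SimplyConnectedSpace E3 := inferInstance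
  obtain ⟨s, ⟨hs₀, hs⟩, -⟩ :=
    hf.existsUnique_continuousMap_lifts (ContinuousMap.id E3) (f 0) 0 rfl
  have hs' : f ∘ (s : E3 → E3) = id := hs
  have hsec : (s : E3 → E3) ∘ f = id := by
    refine hf.eq_of_comp_eq (s.continuous.comp hf.continuous) continuous_id ?_ 0 ?_
    · change (f ∘ (s : E3 → E3)) ∘ f = f ∘ id
      rw [hs']
      rfl
    · simp [hs₀]
  exact ⟨LeftInverse.injective (g := s) fun m => congrFun hsec m,
    RightInverse.surjective (g := s) fun y => congrFun hs' y⟩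

/-- **Lipschitz globalisation**: a continuous self-map of `ℝ³` that is `K`-Lipschitz on a
neighbourhood of every point is `K`-Lipschitz (continuous induction along the segment).
[folklore] -/
theorem dist_le_of_locally_lipschitz {F : E3 → E3} {K : ℝ} (hF : Continuous F)
    (hloc : ∀ w : E3, ∃ N ∈ 𝓝 w, ∀ w₁ ∈ N, ∀ w₂ ∈ N, dist (F w₁) (F w₂) ≤ K * dist w₁ w₂)
    (u v : E3) : dist (F u) (F v) ≤ K * dist u v := by
  set γ : ℝ → E3 := fun t => u + t • (v - u) with hγ
  have hγc : Continuous γ := by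
    simp only [hγ]
    fun_prop
  have hγ0 : γ 0 = u := by simp [hγ]
  have hγ1 : γ 1 = v := by simp [hγ]
  have hγd : ∀ t t' : ℝ, dist (γ t) (γ t') = |t - t'| * dist u v := by
    intro t t'
    simp only [hγ, dist_eq_norm]
    rw [show u + t • (v - u) - (u + t' • (v - u)) = (t - t') • (v - u) by rw [sub_smul]; abel,
      norm_smul, Real.norm_eq_abs, norm_sub_rev]
  set s : Set ℝ := {t | dist (F u) (F (γ t)) ≤ K * (t * dist u v)} with hs
  have hclosed : IsClosed s :=
    isClosed_le (continuous_const.dist (hF.comp hγc))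
      (continuous_const.mul (continuous_id.mul continuous_const))
  have h0 : (0 : ℝ) ∈ s := by simp [hs, hγ0]
  have key : Icc (0 : ℝ) 1 ⊆ s := by
    refine (hclosed.inter isClosed_Icc).Icc_subset_of_forall_mem_nhdsWithin h0 ?_
    rintro t ⟨hts, -, -⟩
    obtain ⟨N, hN, hNlip⟩ := hloc (γ t)
    have hpre : γ ⁻¹' N ∈ 𝓝 t := hγc.continuousAt.preimage_mem_nhds hN
    have hγt : γ t ∈ N := mem_of_mem_nhds hN
    filter_upwards [mem_nhdsWithin_of_mem_nhds hpre, self_mem_nhdsWithin] with t' ht' htt'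
    have h1 := hNlip (γ t) hγt (γ t') ht'
    rw [hγd, abs_of_nonpos (by linarith [mem_Ioi.1 htt'])] at h1
    show dist (F u) (F (γ t')) ≤ K * (t' * dist u v)
    have h2 : dist (F u) (F (γ t)) ≤ K * (t * dist u v) := hts
    calc dist (F u) (F (γ t')) ≤ dist (F u) (F (γ t)) + dist (F (γ t)) (F (γ t')) :=
          dist_triangle _ _ _
      _ ≤ K * (t * dist u v) + K * (-(t - t') * dist u v) := add_le_add h2 h1
      _ = K * (t' * dist u v) := by ring
  have h1 := key (right_mem_Icc.2 zero_le_one)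
  simp only [hs, mem_setOf_eq, hγ1, one_mul] at h1
  exact h1

/-! ## The developed image is an exact FCC/HCP-shelled packing (PROVED) -/

/-- Mazur–Ulam, pointwise: `g z = L z + g 0` with `L` the linear part of `g`. [folklore] -/
theorem isometryEquiv_apply_eq_linear_add (g : E3 ≃ᵢ E3) (z : E3) :
    g z = g.toRealAffineIsometryEquiv.linearIsometryEquiv z + g 0 := by
  have h := g.toRealAffineIsometryEquiv.map_vsub z 0
  simp only [IsometryEquiv.coeFn_toRealAffineIsometryEquiv, vsub_eq_sub, sub_zero] at h
  rw [h, sub_add_cancel]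

/-- **Exact image.**  If a homeomorphism `D` of `ℝ³` is chart-wise a rigid motion after a
straightening chart (`D = g x ∘ φ x` on `U x`) and `D⁻¹` is `9/16`-Lipschitz, then `D '' S` is a
unit-ball packing, every tangent arrangement of `D '' S` is the FCC or the HCP pattern, and bonds
↔ contacts.  Mechanism: `dist (D x) (D y) ≤ 2` forces `dist x y ≤ 9/8 ≤ 5a/4`, i.e.
`y ∈ shell x`; shell points develop by `vertex` + `image_shell` to exact distance `2`
(`D y = g x (φ x y)`, `‖φ x y‖ = 2`); the tangent arrangement at `D x` is the linear part of `g x`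
(Mazur–Ulam) applied to `2 · A x (P x)`; `hwin` turns shell pairs into bonds. [folklore] -/
theorem exactImage (S : Set E3) (a : E3 → ℝ) (P : E3 → Finset E3)
    (A : E3 → (E3 →ₗᵢ[ℝ] E3)) (φ : E3 → E3 → E3) (hC : StraighteningCharts S a P A φ)
    (hwin : ∀ x ∈ S, ∀ y ∈ shell S x (a x), dist y x ≤ 28 / 25)
    (D : E3 ≃ₜ E3) (g : E3 → (E3 ≃ᵢ E3))
    (hD : ∀ x ∈ S, ∀ p ∈ ball x (19 / 25 * a x), D p = g x (φ x p))
    (hLip : ∀ u v : E3, dist (D.symm u) (D.symm v) ≤ 9 / 16 * dist u v) :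
    IsUnitBallPacking (D '' S) ∧ HasFccOrHcpShells (D '' S) ∧
      ∀ x ∈ S, ∀ y ∈ S, (Bond x y ↔ dist (D x) (D y) = 2) := by
  -- centres lie in their chart domains
  have hctr : ∀ x ∈ S, x ∈ ball x (19 / 25 * a x) := fun x hx => by
    have := (hC.adm x hx).1
    exact mem_ball_self (by positivity)
  have hDx : ∀ x ∈ S, D x = g x 0 := fun x hx => by
    rw [hD x hx x (hctr x hx), hC.map_self x hx]
  -- image-close points are shell neighbours
  have hnear : ∀ x ∈ S, ∀ y ∈ S, dist (D x) (D y) ≤ 2 → y = x ∨ y ∈ shell S x (a x) := by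
    intro x hx y hy hd
    by_cases hyx : y = x
    · exact Or.inl hyx
    right
    refine ⟨hy, hyx, ?_⟩
    have h1 := hLip (D x) (D y)
    rw [Homeomorph.symm_apply_apply, Homeomorph.symm_apply_apply, dist_comm x y] at h1
    have ha := (hC.adm x hx).1
    nlinarith
  -- shell points develop through the chart of `x`
  have hdev : ∀ x ∈ S, ∀ y ∈ shell S x (a x), D y = g x (φ x y) := by
    intro x hx y hy
    have hyS : y ∈ S := hy.1
    have key := hC.vertex x hx y hy (g x) (g y)
      (fun p hpx hpy => by rw [← hD x hx p hpx, ← hD y hyS p hpy])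
    rw [key, ← hD y hyS y (hctr y hyS)]
  -- chart images of shell points have norm `2`
  have hunit : ∀ x ∈ S, ∀ v ∈ P x, ‖v‖ = 1 := by
    intro x hx v hv
    rcases hC.pattern x hx with hP | hP
    · rw [hP] at hv; exact norm_eq_one_of_mem_fccKissingPattern hv
    · rw [hP] at hv; exact norm_eq_one_of_mem_hcpKissingPattern hv
  have hnorm2 : ∀ x ∈ S, ∀ y ∈ shell S x (a x), ‖φ x y‖ = 2 := by
    intro x hx y hy
    have : φ x y ∈ (fun v : E3 => (2 : ℝ) • A x v) '' ↑(P x) := by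
      rw [← hC.image_shell x hx]; exact mem_image_of_mem _ hy
    obtain ⟨v, hv, hvy⟩ := this
    rw [← hvy, norm_smul, LinearIsometry.norm_map, Real.norm_two, hunit x hx v hv, mul_one]
  -- shell neighbours develop to exact distance `2`
  have hdist2 : ∀ x ∈ S, ∀ y ∈ shell S x (a x), dist (D x) (D y) = 2 := by
    intro x hx y hy
    rw [hDx x hx, hdev x hx y hy, (g x).dist_eq, dist_comm, dist_zero_right]
    exact hnorm2 x hx y hy
  refine ⟨?_, ?_, ?_⟩
  · -- packing
    rintro _ ⟨x, hx, rfl⟩ _ ⟨y, hy, rfl⟩ hlt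
    rcases hnear x hx y hy hlt.le with rfl | hsh
    · rfl
    · exact absurd (hdist2 x hx y hsh) (ne_of_lt hlt)
  · -- tangent arrangements
    rintro _ ⟨x, hx, rfl⟩
    set L : E3 ≃ₗᵢ[ℝ] E3 := (g x).toRealAffineIsometryEquiv.linearIsometryEquiv with hL
    have hgL : ∀ z : E3, g x z = L z + g x 0 := isometryEquiv_apply_eq_linear_add (g x)
    have hshell_eq : kissingShell (D '' S) (D x) =
        (fun v : E3 => (2 : ℝ) • (L.toLinearIsometry.comp (A x)) v) '' ↑(P x) := by
      ext z
      constructor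
      · rintro ⟨⟨y, hy, hyz⟩, hz⟩
        have hd : dist (D x) (D y) ≤ 2 := by
          rw [hyz, dist_eq_norm, sub_add_cancel_left, norm_neg, hz]
        rcases hnear x hx y hy hd with rfl | hsh
        · exfalso
          have hz0 : z = 0 := by
            have := hyz
            rw [eq_comm, add_eq_left] at this
            exact this
          rw [hz0, norm_zero] at hz
          norm_num at hz
        · have hDy := hdev x hx y hsh
          have hφ : φ x y ∈ (fun v : E3 => (2 : ℝ) • A x v) '' ↑(P x) := by
            rw [← hC.image_shell x hx]; exact mem_image_of_mem _ hsh
          obtain ⟨v, hv, hvy⟩ := hφ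
          refine ⟨v, hv, ?_⟩
          show (2 : ℝ) • L (A x v) = z
          have h1 : z = D y - D x := by rw [hyz]; abel
          rw [h1, hDy, hDx x hx, hgL (φ x y), add_sub_cancel_right, ← hvy, map_smul]
      · rintro ⟨v, hv, rfl⟩
        have hφ : (2 : ℝ) • A x v ∈ φ x '' shell S x (a x) := by
          rw [hC.image_shell x hx]; exact mem_image_of_mem _ hv
        obtain ⟨y, hy, hyv⟩ := hφ
        refine ⟨⟨y, hy.1, ?_⟩, ?_⟩
        · show D y = D x + (2 : ℝ) • L (A x v)
          rw [hdev x hx y hy, hDx x hx, hgL (φ x y), hyv, map_smul, add_comm]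
        · show ‖(2 : ℝ) • L (A x v)‖ = 2
          rw [norm_smul, LinearIsometryEquiv.norm_map, LinearIsometry.norm_map, Real.norm_two,
            hunit x hx v hv, mul_one]
    rcases hC.pattern x hx with hP | hP
    · left
      exact ⟨L.toLinearIsometry.comp (A x), by rw [hshell_eq, hP]⟩
    · right
      exact ⟨L.toLinearIsometry.comp (A x), by rw [hshell_eq, hP]⟩
  · -- bonds ↔ contacts
    intro x hx y hy
    constructor
    · rintro ⟨hpos, hle⟩
      have hyx : y ≠ x := by
        rintro rfl
        rw [dist_self] at hpos
        exact lt_irrefl _ hpos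
      have ha := (hC.adm x hx).1
      have hsh : y ∈ shell S x (a x) := ⟨hy, hyx, by rw [dist_comm]; linarith⟩
      exact hdist2 x hx y hsh
    · intro h2
      rcases hnear x hx y hy h2.le with rfl | hsh
      · rw [dist_self] at h2
        norm_num at h2
      · refine ⟨dist_pos.2 (Ne.symm hsh.2.1), ?_⟩
        rw [dist_comm]
        exact hwin x hx y hsh

/-! ## The composition: stubs ⇒ `C⁺` ⇒ the crux, by name -/

/-- **Glue: the three stub statements ⇒ `ExactStraightening`.**  Builds the `(ℝ³, Isom)`-atlas
`(ball x (19/25·a x), φ x)` indexed by `↥S` (cover by `DeloneControl.covering`, Lebesgue number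
`1/40`), develops it chart-wise, checks the hypotheses of the covering criterion from the chart
axioms (`injOn` / `surjOn` transported by the isometries `g x`), gets a homeomorphism by
`bijective_of_isCoveringMap`, bounds the inverse by `dist_le_of_locally_lipschitz`
(`coLipschitz`), and applies `exactImage`. -/
theorem exactStraightening_of
    (hDel : ∀ S : Set E3, S.Nonempty → (∀ x ∈ S, GoodShellAt (9 / 10) 1 S x) → DeloneControl S)
    (hLink : ∀ S : Set E3, S.Nonempty → (∀ x ∈ S, GoodShellAt (9 / 10) 1 S x) →
      ∀ x ∈ S, ∃ (a : ℝ) (P : Finset E3) (A : E3 →ₗᵢ[ℝ] E3) (ℓ : E3 → E3),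
        LinkExactAt S x a P A ℓ)
    (hCh : ∀ S : Set E3, S.Nonempty → (∀ x ∈ S, GoodShellAt (9 / 10) 1 S x) → DeloneControl S →
      (∀ x ∈ S, ∃ (a : ℝ) (P : Finset E3) (A : E3 →ₗᵢ[ℝ] E3) (ℓ : E3 → E3),
        LinkExactAt S x a P A ℓ) →
      ∃ (a : E3 → ℝ) (P : E3 → Finset E3) (A : E3 → (E3 →ₗᵢ[ℝ] E3)) (φ : E3 → E3 → E3),
        StraighteningCharts S a P A φ) :
    ExactStraightening := by
  intro S hS hgood
  have hDl := hDel S hS hgood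
  obtain ⟨a, P, A, φ, hC⟩ := hCh S hS hgood hDl (hLink S hS hgood)
  -- Lebesgue-number cover of `ℝ³` by the chart domains
  have hcover : ∀ p : E3, ∃ x ∈ S, ball p (1 / 40) ⊆ ball x (19 / 25 * a x) := by
    intro p
    obtain ⟨x, hx, hpx⟩ := hDl.covering p
    refine ⟨x, hx, fun q hq => ?_⟩
    have h1 := hpx (a x) (hC.adm x hx)
    have ha := (hC.adm x hx).1
    rw [mem_ball] at hq ⊢
    calc dist q x ≤ dist q p + dist p x := dist_triangle _ _ _
      _ < 1 / 40 + 29 / 40 * a x := by linarith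
      _ ≤ 19 / 25 * a x := by linarith
  have hself : ∀ p : E3, ∃ x ∈ S, p ∈ ball x (19 / 25 * a x) := fun p => by
    obtain ⟨x, hx, h⟩ := hcover p
    exact ⟨x, hx, h (mem_ball_self (by norm_num))⟩
  -- the straightening atlas on `ℝ³`
  let At : GStructure.Atlas isomSet ↥S E3 :=
    { U := fun i => ball (i : E3) (19 / 25 * a i)
      φ := fun i => φ i
      isOpen_U := fun i => isOpen_ball
      exists_mem := fun p => by
        obtain ⟨x, hx, h⟩ := hself p
        exact ⟨⟨x, hx⟩, h⟩
      nhds_le := fun i p hp => hC.nhds_le i i.2 p hp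
      compat := fun i j p hpi hpj => by
        obtain ⟨g, hg⟩ := hC.compat i i.2 j j.2 p hpi hpj
        exact ⟨g, ⟨g, rfl⟩, hg⟩ }
  obtain ⟨D, hDev'⟩ := chartwiseDevelopment At isomSet_rigid isomSet_compClosed isomSet_nonempty
    (fun i => (convex_ball _ _).isPreconnected)
  choose gfun hgmem hgD using hDev'
  choose giso hgiso using hgmem
  -- `hgiso i : ⇑(giso i) = gfun i`; `hgD i : ∀ p ∈ U i, D =ᶠ[𝓝 p] gfun i ∘ φ i`
  have hDeq : ∀ (i : ↥S), ∀ p ∈ ball (i : E3) (19 / 25 * a i), D p = giso i (φ i p) := by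
    intro i p hp
    have h1 : D p = (gfun i ∘ At.φ i) p := (hgD i p hp).self_of_nhds
    rw [← hgiso i] at h1
    exact h1
  have hDev_ev : ∀ (i : ↥S), ∀ p ∈ ball (i : E3) (19 / 25 * a i),
      D =ᶠ[𝓝 p] (giso i : E3 → E3) ∘ φ i := by
    intro i p hp
    have h1 := hgD i p hp
    rw [← hgiso i] at h1
    exact h1
  -- continuity
  have hDcont : Continuous D := by
    rw [continuous_iff_continuousAt]
    intro p
    obtain ⟨x, hx, hp⟩ := hself p
    have hev := hDev_ev ⟨x, hx⟩ p hp
    have hφ : ContinuousAt (φ x) p :=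
      (hC.continuousOn x hx).continuousAt (isOpen_ball.mem_nhds hp)
    have hcomp : ContinuousAt ((giso ⟨x, hx⟩ : E3 → E3) ∘ φ x) p :=
      (giso ⟨x, hx⟩).continuous.continuousAt.comp hφ
    exact hcomp.congr hev.symm
  -- openness
  have hDopen : IsOpenMap D := by
    refine IsOpenMap.of_nhds_le fun p => ?_
    obtain ⟨x, hx, hp⟩ := hself p
    have hev := hDev_ev ⟨x, hx⟩ p hp
    calc 𝓝 (D p) = 𝓝 ((giso ⟨x, hx⟩) (φ x p)) := by rw [hDeq ⟨x, hx⟩ p hp]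
      _ = map (giso ⟨x, hx⟩) (𝓝 (φ x p)) :=
          ((giso ⟨x, hx⟩).toHomeomorph.map_nhds_eq (φ x p)).symm
      _ ≤ map (giso ⟨x, hx⟩) (map (φ x) (𝓝 p)) := map_mono (hC.nhds_le x hx p hp)
      _ = map ((giso ⟨x, hx⟩ : E3 → E3) ∘ φ x) (𝓝 p) := Filter.map_map
      _ = map D (𝓝 p) := (Filter.map_congr hev).symm
  -- uniform local injectivity
  have hinj : ∀ p : E3, InjOn D (ball p (1 / 40)) := by
    intro p
    obtain ⟨x, hx, hsub⟩ := hcover p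
    intro q hq q' hq' h
    rw [hDeq ⟨x, hx⟩ q (hsub hq), hDeq ⟨x, hx⟩ q' (hsub hq')] at h
    exact hC.injOn x hx (hsub hq) (hsub hq') ((giso ⟨x, hx⟩).injective h)
  -- uniform local surjectivity
  have hsur : ∀ p : E3, ball (D p) (1 / 40) ⊆ D '' ball p (1 / 40) := by
    intro p
    obtain ⟨x, hx, hsub⟩ := hcover p
    have hp : p ∈ ball x (19 / 25 * a x) := hsub (mem_ball_self (by norm_num))
    intro w hw
    rw [hDeq ⟨x, hx⟩ p hp] at hw
    have hw' : (giso ⟨x, hx⟩).symm w ∈ ball (φ x p) (1 / 40) := by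
      rw [mem_ball] at hw ⊢
      rw [← (giso ⟨x, hx⟩).dist_eq, IsometryEquiv.apply_symm_apply]
      exact hw
    obtain ⟨q, hq, hqw⟩ := hC.surjOn x hx p hsub hw'
    refine ⟨q, hq, ?_⟩
    rw [hDeq ⟨x, hx⟩ q (hsub hq), hqw, IsometryEquiv.apply_symm_apply]
  have hcovmap : IsCoveringMap D :=
    isCoveringMap_of_uniform D (1 / 40) (1 / 40) hDcont hDopen (by norm_num) (by norm_num)
      hinj hsur
  have hbij : Bijective D := bijective_of_isCoveringMap hcovmap
  let Dh : E3 ≃ₜ E3 := (Equiv.ofBijective D hbij).toHomeomorphOfContinuousOpen hDcont hDopen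
  have hDh : ∀ p, Dh p = D p := fun p => rfl
  have hDhsymm : ∀ w, D (Dh.symm w) = w := fun w => by
    rw [← hDh]; exact Dh.apply_symm_apply w
  -- the inverse is globally `9/16`-Lipschitz
  have hLip : ∀ u v : E3, dist (Dh.symm u) (Dh.symm v) ≤ 9 / 16 * dist u v := by
    refine dist_le_of_locally_lipschitz Dh.symm.continuous (fun w => ?_)
    obtain ⟨x, hx, hsub⟩ := hcover (Dh.symm w)
    refine ⟨Dh.symm ⁻¹' ball (Dh.symm w) (1 / 80),
      Dh.symm.continuous.continuousAt.preimage_mem_nhds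
        (isOpen_ball.mem_nhds (mem_ball_self (by norm_num))), ?_⟩
    intro w₁ hw₁ w₂ hw₂
    have key := hC.coLipschitz x hx (Dh.symm w) hsub (Dh.symm w₁) hw₁ (Dh.symm w₂) hw₂
    have hsub' : ball (Dh.symm w) (1 / 80) ⊆ ball x (19 / 25 * a x) :=
      (ball_subset_ball (by norm_num)).trans hsub
    have h1 : giso ⟨x, hx⟩ (φ x (Dh.symm w₁)) = w₁ := by
      rw [← hDeq ⟨x, hx⟩ _ (hsub' hw₁), hDhsymm]
    have h2 : giso ⟨x, hx⟩ (φ x (Dh.symm w₂)) = w₂ := by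
      rw [← hDeq ⟨x, hx⟩ _ (hsub' hw₂), hDhsymm]
    have h3 : dist (φ x (Dh.symm w₁)) (φ x (Dh.symm w₂)) = dist w₁ w₂ := by
      rw [← (giso ⟨x, hx⟩).dist_eq, h1, h2]
    rw [h3] at key
    exact key
  -- shell pairs are window pairs
  have hwin : ∀ x ∈ S, ∀ y ∈ shell S x (a x), dist y x ≤ 28 / 25 := by
    intro x hx y hy
    have h := (hDl.shell_window x hx (a x) (hC.adm x hx) y hy).2
    have ha1 := (hC.adm x hx).2.1
    linarith
  classical
  let g : E3 → (E3 ≃ᵢ E3) := fun x => if hx : x ∈ S then giso ⟨x, hx⟩ else IsometryEquiv.refl E3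
  have hgD' : ∀ x ∈ S, ∀ p ∈ ball x (19 / 25 * a x), Dh p = g x (φ x p) := by
    intro x hx p hp
    simp only [g, dif_pos hx, hDh]
    exact hDeq ⟨x, hx⟩ p hp
  obtain ⟨hpack, hshells, hbond⟩ := exactImage S a P A φ hC hwin Dh g hgD' hLip
  exact ⟨Dh, hpack, hshells, hbond⟩

/-- **The composition `ShellsToBarlowChart_of`: the three stub statements imply the crux, BY
NAME** (`Summit.AtomisticToContinuum.Crystallization.Theses.PalmUnimodularRigidity.ShellsToBarlowChart`),
through `exactStraightening_of` and the proved transfer `shellsToBarlowChart_of_exactStraightening`. -/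
theorem ShellsToBarlowChart_of
    (hDel : ∀ S : Set E3, S.Nonempty → (∀ x ∈ S, GoodShellAt (9 / 10) 1 S x) → DeloneControl S)
    (hLink : ∀ S : Set E3, S.Nonempty → (∀ x ∈ S, GoodShellAt (9 / 10) 1 S x) →
      ∀ x ∈ S, ∃ (a : ℝ) (P : Finset E3) (A : E3 →ₗᵢ[ℝ] E3) (ℓ : E3 → E3),
        LinkExactAt S x a P A ℓ)
    (hCh : ∀ S : Set E3, S.Nonempty → (∀ x ∈ S, GoodShellAt (9 / 10) 1 S x) → DeloneControl S →
      (∀ x ∈ S, ∃ (a : ℝ) (P : Finset E3) (A : E3 →ₗᵢ[ℝ] E3) (ℓ : E3 → E3),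
        LinkExactAt S x a P A ℓ) →
      ∃ (a : E3 → ℝ) (P : E3 → Finset E3) (A : E3 → (E3 →ₗᵢ[ℝ] E3)) (φ : E3 → E3 → E3),
        StraighteningCharts S a P A φ) :
    Summit.AtomisticToContinuum.Crystallization.Theses.PalmUnimodularRigidity.ShellsToBarlowChart :=
  shellsToBarlowChart_of_exactStraightening (exactStraightening_of hDel hLink hCh)

/-- The line assembled from its registered stubs (type-checks that the stub signatures are
literally the hypotheses of `ShellsToBarlowChart_of`; inherits the stubs' `sorry`s). -/
theorem shellsToBarlowChart_via_stubs :
    Summit.AtomisticToContinuum.Crystallization.Theses.PalmUnimodularRigidity.ShellsToBarlowChart :=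
  ShellsToBarlowChart_of stub_deloneControl stub_linkExact stub_straighteningCharts

end Summit.AtomisticToContinuum.Crystallization.Cruxes.ShellsToBarlowChart.StraighteningDevelopment

end
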